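import Literature.Geometry.Kaehler.ComplexTorusMiddleHodgeLatticeIsomorphismInvariance
import Literature.Geometry.Kaehler.ComplexTorusDivisorClassesIsogeny
import Literature.Geometry.Kaehler.ComplexTorusIsogenyPullbackVolume
import HarnessLib

/-!
# The middle Hodge lattice `Hdgᵖ(X, ℤ) ⊂ H^{2p}(X, ℤ)` and its transcendental complement `T_X` under ISOGENIES of complex tori of
# dimension `2p`: `⟨f^*x, f^*y⟩_X = det ρ_r(f) · ⟨x, y⟩_{X′} = ± deg f · ⟨x, y⟩_{X′}`, `f^* T_{X′} ⊆ T_X`,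
# `e(f)^{2p} · T_X ⊆ f^* T_{X′}`, `rk T_X = rk T_{X′}`, and `f^*|_{T_{X′}} : T_{X′} ↪ T_X` has finite index

Layer `Literature/Geometry/Kaehler`, namespace `Literature.Geometry.Kaehler.ComplexTorus`; lane `lit-hodgefound` (Track 2
foundations library), seat p09, generation 31, row g31-#7. THEOREMS ONLY (0 definitions); no named fact, net debt 0. The ISOGENY
companion of g31-#3 (`ComplexTorusMiddleHodgeLatticeIsomorphismInvariance`: isomorphisms act by isometries, `f^* T′ = T`) and of
g31-#6 (`ComplexTorusIntegralHodgeClassesIsogeny`: `f^* Hdg(X′, ℤ) ⊆ Hdg(X, ℤ)` of finite index, `e(f)ᵏ · Hdg ⊆ f^* Hdg′`), for the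
middle lattice `(H^{2p}(X, ℤ), ⟨ , ⟩)` of a torus of dimension `g = 2p` (`e : Fin (2g) ≃ ι`, `h : 2p + 2p = 2g`; `⟨x, y⟩_e =
sign(e) ∫_X x ∧ y`, the tree's `poincarePairing` / `poincarePairing_eq_orientationSign_mul_torusIntegral_wedge`), its Hodge sublattice
`Hdg = Hdgᵖ(X, ℤ)` and `T = Hdg^⊥` (g30-#4/#5/#9: `B.orthogonal (toIntSubmodule (Hdg.addSubgroupOf H^{2p}(X, ℤ)))` for any `ℤ`-form `B`
agreeing with `⟨ , ⟩`):

* Lange 2023 §1.7.2 Cor. 1.7.6 (proof): "`∫_Y f^*ω = (Λ : ρ_r(f)(Λ′)) ∫_X ω`" (the tree's `torusIntegral_comp_realRep_eq_sign_mul`,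
  `torusIntegral_comp_realRep`) ⟹ **`⟨f^*x, f^*y⟩_e = det(ρ_r(A)_{e′e}) · ⟨x, y⟩_{e′}`** for every integral `A` (§1), `= ± deg f ·
  ⟨x, y⟩_{e′}` for a homomorphism;
* Lange 2023 §1.1.2 Prop. 1.1.15 ("`gf = e_X`", `e = e(f)` the exponent; the degree-`2p` case of g31-#6's `e(f)ᵏ · Hdg ⊆ f^* Hdg′`,
  re-derived privately here) ⟹ **`f^* T_{X′} ⊆ T_X`** for an isogeny `f` (§2:
  for `s ∈ Hdg_X`, `e^{2p} s = f^* s′` with `s′ ∈ Hdg_{X′}`, so `e^{2p} ⟨s, f^*t⟩ = det · ⟨s′, t⟩ = 0`), **`e^{2p} · T_X ⊆ f^* T_{X′}`**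
  (apply §2 to the quasi-inverse `g`), `rk T_X = C(2g, 2p) − rk Hdgᵖ(X, ℤ) = rk T_{X′}` (§3; Shioda–Mitani's `T_X` has isogeny-invariant
  rank), and `f^*|_{T′} : T_{X′} → T_X` is an injective `ℤ`-linear map with finite cokernel.

## Contents (theorems only)

* §1 **`poincarePairing_comp_realRep_eq_det_mul`** (any integral `A`; DISCLOSED near-relative: `poincarePairing_compContinuousLinearMap_realRep`
  of `ComplexTorusAnalyticCycleClassIsogeny`, stated under `InnerProductSpace`/universe-`u` hypotheses for general degrees; g31-#3's
  `poincarePairing_comp_realRep_of_mul_eq_one` is the case `A A′ = 1`), `poincarePairing_comp_realRep_eq_sign_mul_natAbs_det_mul` (`ρ(A)` `ℂ`-linear).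
* §2 **`IsIsogeny.comp_realRep_mem_orthogonal_hodgeSublattice`** (`f^* T′ ⊆ T`), **`IsIsogeny.exists_comp_realRep_eq_pow_smul_of_mem_orthogonal_hodgeSublattice`**
  (`∀ t ∈ T, ∃ t′ ∈ T′, f^*t′ = e^{2p} · t`).
* §3 **`IsIsogeny.finrank_orthogonal_hodgeSublattice_eq`**, `IsIsogenous.finrank_orthogonal_hodgeSublattice_eq` (`rk T_X = rk T_{X′}`),
  **`IsIsogeny.exists_intLinearMap_orthogonal_hodgeSublattice_injective_finite`** (`f^*|_{T′}` injective, `Finite (T ⧸ f^*T′)`).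

## References

* [cite: Lange2023AbelianVarietiesComplex, §1.7.2 Cor. 1.7.6 (proof); §1.1.2 Prop. 1.1.15 (PDF p. 22); §7.3.3 Exercise (1)(a) (PDF p. 341); §6.2.4 (p. 310); §7.2.2]
* [cite: ShiodaMitani1974, §1 (1.5) and §3 (3.19) (`X ↦ T_X`)]
* [cite: Huybrechts2016K3, Ch. 3 §2.2–2.3 (PDF pp. 58–59: the transcendental lattice); Ch. 14 §0.1 (PDF p. 333)]
-/

noncomputable section

open Module Function
open LinearMap (BilinForm)

namespace Literature.Geometry.Kaehler.ComplexTorus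

section TwoTori

variable {ι ι' : Type*} [Fintype ι] [Fintype ι'] [DecidableEq ι] [DecidableEq ι']
  {E E' : Type*} [NormedAddCommGroup E] [NormedSpace ℂ E] [NormedAddCommGroup E'] [NormedSpace ℂ E']
  (Φ : (ι → ℝ) ≃L[ℝ] E) (Φ' : (ι' → ℝ) ≃L[ℝ] E') {g p : ℕ} (e : Fin (2 * g) ≃ ι) (e' : Fin (2 * g) ≃ ι')
  (h : 2 * p + 2 * p = 2 * g)

/-! ## §1 `⟨f^*x, f^*y⟩_X = det ρ_r(f) · ⟨x, y⟩_{X′}` -/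

/-- **`⟨ρ(A)^*x, ρ(A)^*y⟩_e = det(A_{e′e}) · ⟨x, y⟩_{e′}`** for EVERY integer matrix `A : ι′ × ι` between tori of the same dimension
`2p` (`⟨x, y⟩_e = sign(e) ∫_X x ∧ y`; `∫_X ρ(A)^*θ = sign(e) sign(e′) det(A_{e′e}) ∫_{X′} θ`, the tree's
`torusIntegral_comp_realRep_eq_sign_mul`; `A_{e′e} = A.submatrix e′ e` in the chosen lattice orderings). For a homomorphism of
complex tori `det(A_{e′e}) = sign(e) sign(e′) deg f`. [cite: Lange2023AbelianVarietiesComplex, §1.7.2 Cor. 1.7.6 (proof) and §6.2.4 (p. 310)] [cite: ShiodaMitani1974, §1 (1.5)] -/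
theorem poincarePairing_comp_realRep_eq_det_mul (A : Matrix ι' ι ℤ) (x y : E' [⋀^Fin (2 * p)]→L[ℝ] ℂ) :
    poincarePairing Φ e h (x.compContinuousLinearMap (realRep Φ Φ' A)) (y.compContinuousLinearMap (realRep Φ Φ' A)) =
      ((A.submatrix ((finCongr h).trans e') ((finCongr h).trans e)).det : ℂ) * poincarePairing Φ' e' h x y := by
  rw [poincarePairing_eq_orientationSign_mul_torusIntegral_wedge,
    poincarePairing_eq_orientationSign_mul_torusIntegral_wedge Φ' e' h, ← ContinuousAlternatingMap.wedge_compContinuousLinearMap,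
    torusIntegral_comp_realRep_eq_sign_mul Φ Φ' A ((finCongr h).trans e) ((finCongr h).trans e') (x.wedge y)]
  have hs : (orientationSign Φ ((finCongr h).trans e) : ℂ) * orientationSign Φ ((finCongr h).trans e) = 1 := by
    exact_mod_cast orientationSign_mul_self Φ ((finCongr h).trans e)
  simp only [Int.cast_mul]
  linear_combination ((orientationSign Φ' ((finCongr h).trans e') : ℂ) *
    ((A.submatrix ((finCongr h).trans e') ((finCongr h).trans e)).det : ℂ) *
      torusIntegral Φ' ((finCongr h).trans e') (x.wedge y)) * hs

/-- **`⟨f^*x, f^*y⟩_e = sign(e) sign(e′) · deg f · ⟨x, y⟩_{e′}`** for a homomorphism `f = ρ(A)` of complex tori of dimension `2p`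
(`ρ_r(A)` `ℂ`-linear; `deg f = |det A_{e′e}| = (Λ′ : ρ_r(A)Λ)` for an isogeny, `0` otherwise — the tree's `torusIntegral_comp_realRep`).
[cite: Lange2023AbelianVarietiesComplex, §1.7.2 Cor. 1.7.6 (proof: "`∫_Y f^*ω = (Λ : ρ_r(f)(Λ′)) ∫_X ω`")] [cite: ShiodaMitani1974, §1 (1.5)] -/
theorem poincarePairing_comp_realRep_eq_sign_mul_natAbs_det_mul (A : Matrix ι' ι ℤ)
    (hA : ∀ (c : ℂ) (u : E), realRep Φ Φ' A (c • u) = c • realRep Φ Φ' A u) (x y : E' [⋀^Fin (2 * p)]→L[ℝ] ℂ) :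
    poincarePairing Φ e h (x.compContinuousLinearMap (realRep Φ Φ' A)) (y.compContinuousLinearMap (realRep Φ Φ' A)) =
      ((orientationSign Φ ((finCongr h).trans e) * orientationSign Φ' ((finCongr h).trans e') : ℤ) : ℂ) *
        ((A.submatrix ((finCongr h).trans e') ((finCongr h).trans e)).det.natAbs : ℂ) * poincarePairing Φ' e' h x y := by
  rw [poincarePairing_comp_realRep_eq_det_mul, ← Int.cast_natCast,
    ← sign_mul_sign_mul_det_submatrix_eq_natAbs Φ Φ' A hA ((finCongr h).trans e) ((finCongr h).trans e')]
  have hs : (orientationSign Φ ((finCongr h).trans e) : ℂ) * orientationSign Φ ((finCongr h).trans e) = 1 := by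
    exact_mod_cast orientationSign_mul_self Φ ((finCongr h).trans e)
  have hs' : (orientationSign Φ' ((finCongr h).trans e') : ℂ) * orientationSign Φ' ((finCongr h).trans e') = 1 := by
    exact_mod_cast orientationSign_mul_self Φ' ((finCongr h).trans e')
  simp only [Int.cast_mul]
  linear_combination (-(((A.submatrix ((finCongr h).trans e') ((finCongr h).trans e)).det : ℂ) * poincarePairing Φ' e' h x y *
      ((orientationSign Φ' ((finCongr h).trans e') : ℂ) * orientationSign Φ' ((finCongr h).trans e')))) * hs -
    (((A.submatrix ((finCongr h).trans e') ((finCongr h).trans e)).det : ℂ) * poincarePairing Φ' e' h x y) * hs'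

/-! ## §2 `f^* T_{X′} ⊆ T_X` and `e(f)^{2p} · T_X ⊆ f^* T_{X′}` for an isogeny `f` -/

/-- `e(f)^{2p} · Hdgᵖ(X, ℤ) ⊆ f^* Hdgᵖ(X′, ℤ)` for an isogeny `f` (the degree-`2p` case of g31-#6's
`IsIsogeny.exists_comp_realRep_eq_pow_smul_of_mem_integralHodgeClassesIn`, re-derived here from Prop. 1.1.15 so that this file only
depends on the middle-lattice files). [cite: Lange2023AbelianVarietiesComplex, §1.1.2 Prop. 1.1.15 (PDF p. 22)] -/
private theorem exists_comp_realRep_eq_pow_smul_middle {A : Matrix ι' ι ℤ} (hf : IsIsogeny Φ Φ' A)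
    {s : E [⋀^Fin (2 * p)]→L[ℝ] ℂ} (hs : s ∈ integralHodgeClasses Φ p) :
    ∃ s' ∈ integralHodgeClasses Φ' p, s'.compContinuousLinearMap (realRep Φ Φ' A) =
      ((AddMonoid.exponent (mapMatrixHom Φ Φ' A).ker : ℂ) ^ (2 * p)) • s := by
  obtain ⟨Bq, hBq, hBqA, -⟩ := hf.exists_quasiInverse
  refine ⟨s.compContinuousLinearMap (realRep Φ' Φ Bq), comp_realRep_mem_integralHodgeClasses Φ' Φ Bq (hBq.realRep_smul Φ' Φ) hs, ?_⟩
  have hc : (s.compContinuousLinearMap (realRep Φ' Φ Bq)).compContinuousLinearMap (realRep Φ Φ' A) =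
      s.compContinuousLinearMap ((realRep Φ' Φ Bq).comp (realRep Φ Φ' A)) := by
    ext v; rfl
  rw [hc, realRep_mul, hBqA, comp_realRep_smul_one, Int.cast_natCast]

/-- **`f^* T_{X′} ⊆ T_X` for an isogeny `f = ρ(A) : X → X′` of complex tori of dimension `2p`**: for `t ∈ T_{X′} = Hdg_{X′}^⊥` and
`s ∈ Hdg_X`, g31-#6 gives `s′ ∈ Hdg_{X′}` with `f^*s′ = e^{2p} · s` (`e = e(f)`), so `e^{2p} ⟨s, f^*t⟩ = ⟨f^*s′, f^*t⟩ =
det · ⟨s′, t⟩ = 0` and `⟨s, f^*t⟩ = 0`. (Isomorphisms: g31-#3's `comp_realRep_mem_orthogonal_hodgeSublattice`.)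
[cite: Lange2023AbelianVarietiesComplex, §1.1.2 Prop. 1.1.15 (PDF p. 22) and §1.7.2 Cor. 1.7.6 (proof)] [cite: ShiodaMitani1974, §3 (3.19)] [cite: Huybrechts2016K3, Ch. 3 §2.2–2.3] -/
theorem IsIsogeny.comp_realRep_mem_orthogonal_hodgeSublattice {A : Matrix ι' ι ℤ} (hf : IsIsogeny Φ Φ' A)
    {B : BilinForm ℤ (integralForms Φ (2 * p))}
    (hB : ∀ x y : integralForms Φ (2 * p), ((B x y : ℤ) : ℂ) =
      poincarePairing Φ e h (x : E [⋀^Fin (2 * p)]→L[ℝ] ℂ) (y : E [⋀^Fin (2 * p)]→L[ℝ] ℂ))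
    {B' : BilinForm ℤ (integralForms Φ' (2 * p))}
    (hB' : ∀ x y : integralForms Φ' (2 * p), ((B' x y : ℤ) : ℂ) =
      poincarePairing Φ' e' h (x : E' [⋀^Fin (2 * p)]→L[ℝ] ℂ) (y : E' [⋀^Fin (2 * p)]→L[ℝ] ℂ))
    {t : integralForms Φ' (2 * p)}
    (ht : t ∈ B'.orthogonal (AddSubgroup.toIntSubmodule ((integralHodgeClasses Φ' p).addSubgroupOf (integralForms Φ' (2 * p))))) :
    (⟨(t : E' [⋀^Fin (2 * p)]→L[ℝ] ℂ).compContinuousLinearMap (realRep Φ Φ' A), comp_realRep_mem_integralForms Φ Φ' A t.2⟩ :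
        integralForms Φ (2 * p)) ∈
      B.orthogonal (AddSubgroup.toIntSubmodule ((integralHodgeClasses Φ p).addSubgroupOf (integralForms Φ (2 * p)))) := by
  rw [mem_orthogonal_hodgeSublattice_iff Φ e h hB]
  intro s hs
  obtain ⟨s', hs', hs'eq⟩ := exists_comp_realRep_eq_pow_smul_middle Φ Φ' hf hs
  have h0 := (mem_orthogonal_hodgeSublattice_iff Φ' e' h hB').1 ht s' hs'
  have hN : ((AddMonoid.exponent (mapMatrixHom Φ Φ' A).ker : ℂ) ^ (2 * p)) ≠ 0 :=
    pow_ne_zero _ (Nat.cast_ne_zero.2 hf.exponent_ker_pos.ne')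
  have key : ((AddMonoid.exponent (mapMatrixHom Φ Φ' A).ker : ℂ) ^ (2 * p)) *
      poincarePairing Φ e h s ((t : E' [⋀^Fin (2 * p)]→L[ℝ] ℂ).compContinuousLinearMap (realRep Φ Φ' A)) = 0 := by
    rw [← smul_eq_mul, ← LinearMap.smul_apply, ← map_smul, ← hs'eq, poincarePairing_comp_realRep_eq_det_mul Φ Φ' e e' h A,
      h0, mul_zero]
  exact (mul_eq_zero.1 key).resolve_left hN

/-- **`e(f)^{2p} · T_X ⊆ f^* T_{X′}`** for an isogeny `f : X → X′` of exponent `e(f)`: every `t ∈ T_X` has `e^{2p} · t = f^*t′` with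
`t′ = g^*t ∈ T_{X′}`, `g` the quasi-inverse isogeny (`gf = e_X`, Prop. 1.1.15; `g^* T_X ⊆ T_{X′}` by the previous theorem for `g`).
[cite: Lange2023AbelianVarietiesComplex, §1.1.2 Prop. 1.1.15 (PDF p. 22)] [cite: ShiodaMitani1974, §3 (3.19)] -/
theorem IsIsogeny.exists_comp_realRep_eq_pow_smul_of_mem_orthogonal_hodgeSublattice {A : Matrix ι' ι ℤ} (hf : IsIsogeny Φ Φ' A)
    {B : BilinForm ℤ (integralForms Φ (2 * p))}
    (hB : ∀ x y : integralForms Φ (2 * p), ((B x y : ℤ) : ℂ) =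
      poincarePairing Φ e h (x : E [⋀^Fin (2 * p)]→L[ℝ] ℂ) (y : E [⋀^Fin (2 * p)]→L[ℝ] ℂ))
    {B' : BilinForm ℤ (integralForms Φ' (2 * p))}
    (hB' : ∀ x y : integralForms Φ' (2 * p), ((B' x y : ℤ) : ℂ) =
      poincarePairing Φ' e' h (x : E' [⋀^Fin (2 * p)]→L[ℝ] ℂ) (y : E' [⋀^Fin (2 * p)]→L[ℝ] ℂ))
    {t : integralForms Φ (2 * p)}
    (ht : t ∈ B.orthogonal (AddSubgroup.toIntSubmodule ((integralHodgeClasses Φ p).addSubgroupOf (integralForms Φ (2 * p))))) :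
    ∃ t' : integralForms Φ' (2 * p),
      t' ∈ B'.orthogonal (AddSubgroup.toIntSubmodule ((integralHodgeClasses Φ' p).addSubgroupOf (integralForms Φ' (2 * p)))) ∧
        (t' : E' [⋀^Fin (2 * p)]→L[ℝ] ℂ).compContinuousLinearMap (realRep Φ Φ' A) =
          ((AddMonoid.exponent (mapMatrixHom Φ Φ' A).ker : ℂ) ^ (2 * p)) • (t : E [⋀^Fin (2 * p)]→L[ℝ] ℂ) := by
  obtain ⟨Bq, hBq, hBqA, -⟩ := hf.exists_quasiInverse
  refine ⟨⟨(t : E [⋀^Fin (2 * p)]→L[ℝ] ℂ).compContinuousLinearMap (realRep Φ' Φ Bq), comp_realRep_mem_integralForms Φ' Φ Bq t.2⟩,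
    hBq.comp_realRep_mem_orthogonal_hodgeSublattice Φ' Φ e' e h hB' hB ht, ?_⟩
  have hc : ((t : E [⋀^Fin (2 * p)]→L[ℝ] ℂ).compContinuousLinearMap (realRep Φ' Φ Bq)).compContinuousLinearMap (realRep Φ Φ' A) =
      (t : E [⋀^Fin (2 * p)]→L[ℝ] ℂ).compContinuousLinearMap ((realRep Φ' Φ Bq).comp (realRep Φ Φ' A)) := by
    ext v; rfl
  change ((t : E [⋀^Fin (2 * p)]→L[ℝ] ℂ).compContinuousLinearMap (realRep Φ' Φ Bq)).compContinuousLinearMap (realRep Φ Φ' A) = _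
  rw [hc, realRep_mul, hBqA, comp_realRep_smul_one, Int.cast_natCast]

/-! ## §3 `rk T_X = rk T_{X′}`; `f^*|_{T′} : T_{X′} ↪ T_X` has finite index -/

/-- **`rk T_X = rk T_{X′}` along an isogeny of tori of dimension `2p`** (`rk T = C(2g, 2p) − rk Hdgᵖ(−, ℤ)`, g30-#9, and
`rk Hdgᵖ(X, ℤ) = rk Hdgᵖ(X′, ℤ)`, g31-#6 / Exercise 7.3.3 (1)(a)). [cite: Lange2023AbelianVarietiesComplex, §7.3.3 Exercise (1)(a) (PDF p. 341) and §7.2.2] [cite: ShiodaMitani1974, §3 (3.19)] [cite: Huybrechts2016K3, Ch. 3 §2.3 (PDF p. 59)] -/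
theorem IsIsogeny.finrank_orthogonal_hodgeSublattice_eq {A : Matrix ι' ι ℤ} (hf : IsIsogeny Φ Φ' A)
    {B : BilinForm ℤ (integralForms Φ (2 * p))}
    (hB : ∀ x y : integralForms Φ (2 * p), ((B x y : ℤ) : ℂ) =
      poincarePairing Φ e h (x : E [⋀^Fin (2 * p)]→L[ℝ] ℂ) (y : E [⋀^Fin (2 * p)]→L[ℝ] ℂ))
    {B' : BilinForm ℤ (integralForms Φ' (2 * p))}
    (hB' : ∀ x y : integralForms Φ' (2 * p), ((B' x y : ℤ) : ℂ) =
      poincarePairing Φ' e' h (x : E' [⋀^Fin (2 * p)]→L[ℝ] ℂ) (y : E' [⋀^Fin (2 * p)]→L[ℝ] ℂ)) :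
    finrank ℤ (B.orthogonal (AddSubgroup.toIntSubmodule ((integralHodgeClasses Φ p).addSubgroupOf (integralForms Φ (2 * p))))) =
      finrank ℤ (B'.orthogonal (AddSubgroup.toIntSubmodule ((integralHodgeClasses Φ' p).addSubgroupOf (integralForms Φ' (2 * p))))) := by
  rw [ComplexTorus.finrank_orthogonal_hodgeSublattice_eq Φ e h hB, ComplexTorus.finrank_orthogonal_hodgeSublattice_eq Φ' e' h hB']
  change (2 * g).choose (2 * p) - finrank ℚ (hodgeClassesIn Φ (2 * p) p) = (2 * g).choose (2 * p) - finrank ℚ (hodgeClassesIn Φ' (2 * p) p)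
  rw [hf.finrank_hodgeClassesIn_eq Φ Φ' (k := 2 * p) p]

/-- **`rk T_X = rk T_{X′}` for isogenous complex tori of dimension `2p`.** [cite: ShiodaMitani1974, §3 (3.19)] [cite: Lange2023AbelianVarietiesComplex, §7.3.3 Exercise (1)(a)] -/
theorem IsIsogenous.finrank_orthogonal_hodgeSublattice_eq (hiso : IsIsogenous Φ Φ')
    {B : BilinForm ℤ (integralForms Φ (2 * p))}
    (hB : ∀ x y : integralForms Φ (2 * p), ((B x y : ℤ) : ℂ) =
      poincarePairing Φ e h (x : E [⋀^Fin (2 * p)]→L[ℝ] ℂ) (y : E [⋀^Fin (2 * p)]→L[ℝ] ℂ))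
    {B' : BilinForm ℤ (integralForms Φ' (2 * p))}
    (hB' : ∀ x y : integralForms Φ' (2 * p), ((B' x y : ℤ) : ℂ) =
      poincarePairing Φ' e' h (x : E' [⋀^Fin (2 * p)]→L[ℝ] ℂ) (y : E' [⋀^Fin (2 * p)]→L[ℝ] ℂ)) :
    finrank ℤ (B.orthogonal (AddSubgroup.toIntSubmodule ((integralHodgeClasses Φ p).addSubgroupOf (integralForms Φ (2 * p))))) =
      finrank ℤ (B'.orthogonal (AddSubgroup.toIntSubmodule ((integralHodgeClasses Φ' p).addSubgroupOf (integralForms Φ' (2 * p))))) := by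
  obtain ⟨A, hA⟩ := hiso
  exact hA.finrank_orthogonal_hodgeSublattice_eq Φ Φ' e e' h hB hB'

/-- **`f^*|_{T_{X′}} : T_{X′} → T_X` is an injective `ℤ`-linear map with cokernel FINITE** for an isogeny `f : X → X′` of tori of
dimension `2p` (injective: `comp_realRep_injective_of_isogeny`; equal ranks: `IsIsogeny.finrank_orthogonal_hodgeSublattice_eq`; finite
quotient: Mathlib's `Submodule.finiteQuotientOfFreeOfRankEq`; an explicit exponent is `e(f)^{2p}`).
[cite: Lange2023AbelianVarietiesComplex, §1.1.2 Prop. 1.1.15 (PDF p. 22) and §7.3.3 Exercise (1)(a)] [cite: ShiodaMitani1974, §3 (3.19)] [cite: Huybrechts2016K3, Ch. 14 §0.1 (PDF p. 333)] -/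
theorem IsIsogeny.exists_intLinearMap_orthogonal_hodgeSublattice_injective_finite {A : Matrix ι' ι ℤ} (hf : IsIsogeny Φ Φ' A)
    {B : BilinForm ℤ (integralForms Φ (2 * p))}
    (hB : ∀ x y : integralForms Φ (2 * p), ((B x y : ℤ) : ℂ) =
      poincarePairing Φ e h (x : E [⋀^Fin (2 * p)]→L[ℝ] ℂ) (y : E [⋀^Fin (2 * p)]→L[ℝ] ℂ))
    {B' : BilinForm ℤ (integralForms Φ' (2 * p))}
    (hB' : ∀ x y : integralForms Φ' (2 * p), ((B' x y : ℤ) : ℂ) =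
      poincarePairing Φ' e' h (x : E' [⋀^Fin (2 * p)]→L[ℝ] ℂ) (y : E' [⋀^Fin (2 * p)]→L[ℝ] ℂ)) :
    ∃ R : B'.orthogonal (AddSubgroup.toIntSubmodule ((integralHodgeClasses Φ' p).addSubgroupOf (integralForms Φ' (2 * p)))) →ₗ[ℤ]
        B.orthogonal (AddSubgroup.toIntSubmodule ((integralHodgeClasses Φ p).addSubgroupOf (integralForms Φ (2 * p)))),
      (∀ t, ((R t : integralForms Φ (2 * p)) : E [⋀^Fin (2 * p)]→L[ℝ] ℂ) =
          ((t : integralForms Φ' (2 * p)) : E' [⋀^Fin (2 * p)]→L[ℝ] ℂ).compContinuousLinearMap (realRep Φ Φ' A)) ∧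
        Injective R ∧
          Finite (B.orthogonal (AddSubgroup.toIntSubmodule ((integralHodgeClasses Φ p).addSubgroupOf (integralForms Φ (2 * p)))) ⧸
            LinearMap.range R) := by
  set T := B.orthogonal (AddSubgroup.toIntSubmodule ((integralHodgeClasses Φ p).addSubgroupOf (integralForms Φ (2 * p)))) with hT
  set T' := B'.orthogonal (AddSubgroup.toIntSubmodule ((integralHodgeClasses Φ' p).addSubgroupOf (integralForms Φ' (2 * p))))
    with hT'
  let R : T' →ₗ[ℤ] T :=
    (AddMonoidHom.mk' (fun t : T' ↦ (⟨⟨((t : integralForms Φ' (2 * p)) : E' [⋀^Fin (2 * p)]→L[ℝ] ℂ).compContinuousLinearMap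
        (realRep Φ Φ' A), comp_realRep_mem_integralForms Φ Φ' A (t : integralForms Φ' (2 * p)).2⟩,
        hf.comp_realRep_mem_orthogonal_hodgeSublattice Φ Φ' e e' h hB hB' t.2⟩ : T))
      fun _ _ ↦ Subtype.ext (Subtype.ext (by ext v; rfl))).toIntLinearMap
  have hR : ∀ t, ((R t : integralForms Φ (2 * p)) : E [⋀^Fin (2 * p)]→L[ℝ] ℂ) =
      ((t : integralForms Φ' (2 * p)) : E' [⋀^Fin (2 * p)]→L[ℝ] ℂ).compContinuousLinearMap (realRep Φ Φ' A) := fun _ ↦ rfl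
  obtain ⟨Bq, -, -, hABq⟩ := hf.exists_quasiInverse
  have hN : (AddMonoid.exponent (mapMatrixHom Φ Φ' A).ker : ℤ) ≠ 0 := Int.natCast_ne_zero.2 hf.exponent_ker_pos.ne'
  have hinj : Injective R := fun t t' htt ↦ by
    have h' := congrArg (fun z : T ↦ ((z : integralForms Φ (2 * p)) : E [⋀^Fin (2 * p)]→L[ℝ] ℂ)) htt
    simp only [hR] at h'
    exact Subtype.ext (Subtype.ext (comp_realRep_injective_of_isogeny Φ Φ' A Bq hN hABq h'))
  haveI : Module.Free ℤ (integralForms Φ (2 * p)) := free_integralForms Φ (2 * p)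
  haveI : Module.Finite ℤ (integralForms Φ (2 * p)) := finite_integralForms Φ (2 * p)
  haveI : Module.Finite ℤ T := inferInstance
  haveI : Module.IsTorsionFree ℤ T := Function.Injective.moduleIsTorsionFree T.subtype T.injective_subtype (map_smul T.subtype)
  haveI : Module.Free ℤ T := inferInstance
  have hrk : finrank ℤ (LinearMap.range R) = finrank ℤ T := by
    rw [← (LinearEquiv.ofInjective R hinj).finrank_eq, hT, hT', hf.finrank_orthogonal_hodgeSublattice_eq Φ Φ' e e' h hB hB']
  exact ⟨R, hR, hinj, Submodule.finiteQuotientOfFreeOfRankEq _ hrk⟩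

end TwoTori

end Literature.Geometry.Kaehler.ComplexTorus
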